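import Summits.AnomalousDissipation.AnomalousDissipation.Theorems.SolenoidalFractalHomogenisationLagrangianStepVmodSfTextsP
import HarnessLib

/-!
# K1L_D (stmt-AnomalousDissipation-27980): (V_mod) FLAT STAGE — the per-label (ff) sideband text at GRID window starts `FFModeP_textEVH`
# (prover ad-k3l-bookkeeping-p1 g10; RULING D28-9 / D28-17 (a) assign the (ff) grid twin to the k3l lineage; `--kind definition`; definition only)

The (ff) twin of `SFModeP_textEVH e` (`…VmodSfTextsP`, p721442).  The (ff) block pairs a FAST datum with a FAST test; after the Leray
projection and the class-pair decomposition of the datum (`…VmodFfAssembly`), what each nonzero slow label `ℓ` must deliver is a bound for the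
cell member on a weakly divergence-free FAST CLASS DATUM `w` (Fourier support in the class pair `±ℓ + nℤ³`, vanishing AT `±ℓ`) against a fast
test, in the plain `‖w‖·‖ζ‖` currency (both (ff) losses saturate past one period, so no `√dW` weight appears):
* **`FFModeP_textEVH e`** — binder list of `Bff_textEVHP e` (= that of `Bsf_textEVHP e`), inner regime of `BlockBoundP`, LONG windows at grid starts
  `s = j·(M·W.period/ν) < t ≤ Tw`, `M·W.period/ν < t − s`, nonzero slow label `ℓ ∈ freqBall(n/4) ∖ {0}`, `w ∈ divFreeL2` with
  `(∀ k', 𝓕w(k') ≠ 0 → k' ≡ ±ℓ [n])`, `𝓕w(ℓ) = 𝓕w(−ℓ) = 0`, fast test `ζ`:  `|⟪U s t w, ζ⟫| ≤ C₂(C₂(ν^{eσ} + (⌈K/ν⌉/n)^{eσ}) + (min 1 (P/(t−s)))^{eσ})·‖w‖·‖ζ‖`.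
The rows of the lane (`…VmodFfCoarseMid` p725500, `…VmodFfCoarseLong`, the W7 class-pair decay `…VmodSfHighW7` p718623 for high labels) assemble to
`FFModeP_textEVH e` for `0 < e σ ≤ 1/2`; the grid reduction `bffP_of_ffModeP : FFModeP_textEVH e → Bff_textEVHP e` is the companion proof file.
Definition only; NOT a proof of (ff), of the stub, of K1L_D or AD; rung F-D1.A0.
-/

set_option linter.dupNamespace false

noncomputable section

namespace Summit.AnomalousDissipation.AnomalousDissipation.Theorems.SolenoidalFractalHomogenisation.LagrangianStep.VmodFlat

open Literature.Analysis Literature.Analysis.FluidPDE Literature.Analysis.FunctionSpaces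
open MeasureTheory Set Filter UnitAddTorus
open scoped ENNReal NNReal InnerProductSpace
open Summit.AnomalousDissipation.AnomalousDissipation.Theorems.SolenoidalFractalHomogenisation.LagrangianStep.CellClauseMod

/-- **(ff-mode)ᴾ — THE PER-LABEL SIDEBAND TARGET of the (ff) block on LONG windows at GRID starts**: the cell member on a weakly divergence-free
fast class datum of a nonzero slow label, against a fast test, in the `‖w‖·‖ζ‖` currency. -/
def FFModeP_textEVH (e : ℝ → ℝ) : Prop := ∀ k (W : LatticeShear.LatticeWord k) (M : ℝ) (hM : 0 < M) (c : ℝ), 0 < c →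
  ∀ (Φ : ℝ → Torus.Visc4 (Fin 3) → Torus.Visc4 (Fin 3)) (lo hi Λ β σ C ν₀ K : ℝ),
    0 < lo → lo ≤ 1 → 1 ≤ hi → 1 < Λ → 0 ≤ β → 0 < σ → 0 ≤ C → 0 < ν₀ → ν₀ ≤ 1 → 0 < K →
    SlowVectorClauseF W M hM c Φ lo hi Λ β σ C ν₀ K →
    (∀ Kb : ℝ, 1 ≤ Kb → ∃ CK : ℝ, 1 ≤ CK ∧ ∃ cK > (0:ℝ), ∃ νh > (0:ℝ), HighLabelDecayW W M hM lo hi Λ β νh Kb CK cK) →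
    ∃ C₂ : ℝ, 0 ≤ C₂ ∧
    ∀ ν, ∀ hν : ν ∈ Set.Ioo 0 ν₀, ∀ n : ℕ, (⌈K / ν⌉₊ : ℝ) ≤ n → ∀ 𝔸 : Torus.Visc4 (Fin 3),
      Torus.OddSmall 𝔸 (ν * β) → (∃ lam ∈ Set.Icc (1:ℝ) Λ, Torus.NearIso 𝔸 (ν * (lo / lam)) (ν * (hi * lam))) →
      Torus.OddSmall (Φ ν ((1 / ν) • 𝔸)) β → (∃ lam ∈ Set.Icc (1:ℝ) Λ, Torus.NearIso (Φ ν ((1 / ν) • 𝔸)) (lo / lam) (hi * lam)) →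
      ∀ Tw > (0:ℝ), ∀ U T : ℝ → ℝ → (V2 →L[ℝ] V2),
        Torus.IsPropagator Tw (cellField W M hM ν hν.1 n) ((1 / (n:ℝ) ^ 2) • 𝔸) U →
        Torus.IsPropagator Tw (fun _ _ => 0) ((1 / (n:ℝ) ^ 2) • (𝔸 + (c / ν) • Φ ν ((1 / ν) • 𝔸))) T →
      ∀ j : ℕ, ∀ t : ℝ, let s : ℝ := (j : ℝ) * (M * W.period / ν); s < t → t ≤ Tw → M * W.period / ν < t - s →
      ∀ ℓ ∈ (Torus.freqBall (d := Fin 3) (n / 4)).erase 0, ∀ w : V2, w ∈ Torus.divFreeL2 (Fin 3) →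
        (∀ k', fc w k' ≠ 0 → (∀ i, (n : ℤ) ∣ k' i - ℓ i) ∨ (∀ i, (n : ℤ) ∣ k' i + ℓ i)) → fc w ℓ = 0 → fc w (-ℓ) = 0 →
        ∀ ζ : V2, IsFast n ζ →
        |⟪U s t w, ζ⟫_ℝ|
          ≤ (C₂ * (C₂ * (ν ^ e σ + ((⌈K / ν⌉₊ : ℝ) / n) ^ e σ) + (min 1 ((M * W.period / ν) / (t - s))) ^ e σ)) * ‖w‖ * ‖ζ‖

/-- Degenerate-instance check: the allowance is monotone in its constant, so a larger `C₂` is a weaker demand (used when the rows' constants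
are added). -/
theorem ffModeP_rhs_mono {C₂ C₂' a m x z : ℝ} (hC₂ : 0 ≤ C₂) (hle : C₂ ≤ C₂') (ha : 0 ≤ a) (hm : 0 ≤ m) (hx : 0 ≤ x) (hz : 0 ≤ z) :
    (C₂ * (C₂ * a + m)) * x * z ≤ (C₂' * (C₂' * a + m)) * x * z := by
  have h1 : C₂ * (C₂ * a + m) ≤ C₂' * (C₂' * a + m) :=
    mul_le_mul hle (add_le_add_left (mul_le_mul_of_nonneg_right hle ha) m) (by positivity) (hC₂.trans hle)
  exact mul_le_mul_of_nonneg_right (mul_le_mul_of_nonneg_right h1 hx) hz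

end Summit.AnomalousDissipation.AnomalousDissipation.Theorems.SolenoidalFractalHomogenisation.LagrangianStep.VmodFlat

end
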